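import Summits.Ventures.HSemireg.Pad4FirstOrderModelServerRows

/-!
# Venture HSemireg — THEOREM L^ζ step S3 (concluded): THE FOREIGN-FLAG ROWS (R2) of the top flag's column and the
# packaged COLUMN READING (companion of `Pad4FirstOrderModel.lean`, row 716; TIER-2 step S3, third file)

HONEST FRAMING. PROVED statements about the first-order MODEL of the PAD-4 anchor (seat s4-prove-1 g24, TRACK S4-PUSH lane
(ii), 2026-08-27). `TheoremLZetaMain` ∕ `TheoremLZeta` (p505821) stay kernel-OPEN (`@[conjecture]`); nothing here proves them.
WHAT IS PROVED (notation of `Pad4FirstOrderModelColumnReading.lean`): (R2) `column_reading_R2` — for a top flag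
`X = a ℓ^{(σ)} + h ℓ_ζ^{(f)}`, one solution `η` of `X`'s column at `κ₀ = E_{fσ}`, a third axis `τ ∉ {σ, f}` and every FLAG
`X' = N r = a' ℓ_{ζ'}^{(τ)} + h ℓ_ζ^{(f)}` on it: `Σ_{copies j of Q₀} u_j(x) φ_{X' j}(o) = 0` for all `x ∈ R_a`, `o ∈ R_{a'}`
— the `w_ζ`-image (on the f-index) of the row of `X'` on the block `R_a^* ⊗ V_f ⊗ R_{a'}` of `H²(X' − X)`: pairs
`P ≤ X'` below `h` on `f` feed `ξ̄_ζ^{(f)}` (S3a `coefProd_wImage_eq_zero_of_eval`), τ-ray partners of `X'` charged on `τ`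
would be `≥ 2`-charged at height `h` ((F1) `noP`), `X'`'s own class is killed by `Minimal`, and a copy of `Q₀` contributes
`φ_{X' j}(o) · v_j(x, y)` (identity on `R_a^*` and `V_f`, plain multiplication `ℂ · R_{a'}` on `τ`). THE SAME `u_j` as in
(D) and (R1) — PAD4-THEOREM-L §2 (R2) in the kernel (the TIER-2 sizing memo's §3d shortcut «(R2) not needed, apply `w_τ`»
is NOT used: τ-flags of different τ-phases feed different lines `ξ̄_{ζ'}^{(τ)}`, so (R2) is what THE END consumes).
`column_reading` packages (D) ∧ (R1) ∧ (R2) from `LowerColumnSolvable φ κ₀ i`. THE END is NOT in this file. No variety,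
sheaf or semiregularity map is constructed; nothing here says HC ∕ HC_CM ∕ HC_AV holds; no fact, no definition, no instance,
no notation. REUSE: rows 716, 731, 739, S2a, S2c, S3a, S3 (files 1–2). FRAMING OF RECORD (director-hodge g10, cell INBOX l.31483 (a)): everything in this file is a theorem of the finite-dimensional
FIRST-ORDER MODEL of row 716 (`Pad4FirstOrderModel.lean`) and of nothing else; the model-to-sheaf bridge (Buchweitz–Flenner 2003)
is NOT in the tree; the cell's (S3) ∕ (S5) STATUS WORDS do not move; no object is certified; nothing here bears on HC ∕ HC_CM ∕
HC_AV ∕ W₆ or on `stub_rung_pad4_seedAt`.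
Typed ≠ proved ≠ endorsed.
-/

noncomputable section
namespace Summit.Ventures.HSemireg.Pad4FirstOrder
open Finset

section FlagRows
variable {D : Design} {φ : D.Sections} (T : TopFlag D φ)

/-- a flag on `τ` against a copy of `Q₀`, per factor: `X' − Q₀ = a' ℓ_{ζ'}^{(τ)}`, class `0` off `τ`. -/
theorem TopFlag.isFlagOn_rel_Q0 {τ : Fin 4} (hτf : τ ≠ T.f) {r : Fin D.nN} (hr : T.IsFlagOn τ r)
    {j : Fin D.nP} (hj : T.IsQ0 j) :
    rel (D.N r) (D.P j) τ = Rel.pos ((D.N r).charge τ) ((D.N r).phase τ) ∧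
    ∀ g, g ≠ τ → rel (D.N r) (D.P j) g = Rel.zero := by
  obtain ⟨hQl, hQf, hQph, hQ0⟩ := topFlag_Q0 D φ T j hj
  obtain ⟨hFl, hFph, hFf, hFτ, hF0⟩ := hr
  refine ⟨rel_charged_uncharged _ _ τ (hQl.trans hFl.symm) (hQ0 τ hτf) hFτ, fun g hg => ?_⟩
  by_cases hgf : g = T.f
  · rw [hgf]; exact rel_zero_of_eq _ _ _ (hFl.trans hQl.symm) (by rw [hFf, hQf]) (Or.inr (hFph.trans hQph.symm))
  · exact rel_zero_of_eq _ _ _ (hFl.trans hQl.symm) (by rw [hF0 g hg hgf, hQ0 g hgf]) (Or.inl (hQ0 g hgf))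

/-- (R2), a copy of `Q₀`: its term of the flag row at `(qPair σ f, [σ ↦ x, τ ↦ o, f ↦ y])`, `y ∈ {ē_A, ē_B}`, is
`φ_{X' j}(o) · v_j(x, y)`. -/
theorem flag_term_isQ0 (η : Fin D.nP → (Fin 4 → ℕ) → (Fin 4 → ℕ × ℕ) → ℂ) {τ : Fin 4} (hτσ : τ ≠ T.σ)
    (hτf : τ ≠ T.f) {r : Fin D.nN} (hr : T.IsFlagOn τ r) {j : Fin D.nP} (hj : T.IsQ0 j) {x : ℕ × ℕ}
    (hx : x ∈ monIdx ((D.N T.i).charge T.σ)) {o : ℕ × ℕ} (ho : o ∈ monIdx ((D.N r).charge τ)) (y : ℕ × ℕ)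
    (hy : y = (0, 0) ∨ y = (1, 0)) :
    ∑ u ∈ idxH2 (D.P j) (D.N T.i), ∑ a ∈ idxH0 (D.N r) (D.P j),
        (if u.1 = qPair T.σ T.f then coefProd (rel (D.P j) (D.N T.i)) (rel (D.N r) (D.P j)) (qPair T.σ T.f) u.2 a
          (Function.update (Function.update (Function.update (fun _ => ((0 : ℕ), (0 : ℕ))) T.σ x) τ o) T.f y) else 0) *
          φ r j a * η j u.1 u.2 =
      φ r j (Function.update (fun _ => ((0 : ℕ), (0 : ℕ))) τ o) *
        η j (qPair T.σ T.f) (Function.update (Function.update (fun _ => ((0 : ℕ), (0 : ℕ))) T.σ x) T.f y) := by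
  obtain ⟨hσU, -, hU0, -⟩ := T.isQ0_rel hj
  obtain ⟨hτS, hS0⟩ := T.isFlagOn_rel_Q0 hτf hr hj
  rw [term_restrict _ _ _ _ _ (qPair_mem_qDist2 _ _ T.hσf),
    sum_piFinset_pair _ T.σ T.f T.hσf (fun g hgσ hgf => by rw [hU0 g hgσ, qPair_of_ne hgσ hgf, idx_zero_zero]),
    hσU, qPair_left, idx_neg_one, hU0 T.f T.hσf.symm, qPair_right, idx_zero_one]
  have hc : ∀ x' y' z : ℕ × ℕ, coefProd (rel (D.P j) (D.N T.i)) (rel (D.N r) (D.P j)) (qPair T.σ T.f)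
      (Function.update (Function.update (fun _ => ((0 : ℕ), (0 : ℕ))) T.σ x') T.f y')
      (Function.update (fun _ => ((0 : ℕ), (0 : ℕ))) τ z)
      (Function.update (Function.update (Function.update (fun _ => ((0 : ℕ), (0 : ℕ))) T.σ x) τ o) T.f y) =
      (if x = x' then 1 else 0) * (if y = y' then 1 else 0) * (if o = z then 1 else 0) := by
    intro x' y' z
    rw [coefProd_split3 _ _ _ _ _ _ T.σ T.f τ T.hσf hτσ.symm hτf.symm (fun g hgσ hgf hgτ => by
      rw [hS0 g hgτ, coef_zero_right, update_update_apply_of_ne hgσ hgf, Function.update_of_ne hgf,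
        Function.update_of_ne hgτ, Function.update_of_ne hgσ, if_pos rfl]),
      hσU, hU0 T.f T.hσf.symm, hU0 τ hτσ, hτS, hS0 T.σ hτσ.symm, hS0 T.f hτf.symm, qPair_left, qPair_right,
      qPair_of_ne hτσ hτf]
    simp only [Function.update_self, Function.update_of_ne T.hσf, Function.update_of_ne hτf,
      Function.update_of_ne hτσ, Function.update_of_ne hτσ.symm, Function.update_of_ne hτf.symm, coef_zero_right,
      coef_zero_zero_pos]
  have inner : ∀ x' y' : ℕ × ℕ, ∑ a ∈ idxH0 (D.N r) (D.P j), coefProd (rel (D.P j) (D.N T.i)) (rel (D.N r) (D.P j))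
      (qPair T.σ T.f) (Function.update (Function.update (fun _ => ((0 : ℕ), (0 : ℕ))) T.σ x') T.f y') a
      (Function.update (Function.update (Function.update (fun _ => ((0 : ℕ), (0 : ℕ))) T.σ x) τ o) T.f y) * φ r j a =
      (if x = x' then 1 else 0) * (if y = y' then 1 else 0) * φ r j (Function.update (fun _ => ((0 : ℕ), (0 : ℕ))) τ o) := by
    intro x' y'
    unfold idxH0
    rw [sum_piFinset_single _ τ (fun g hg => by rw [hS0 g hg, idx_zero_zero]), hτS, idx_pos_zero,
      Finset.sum_congr rfl (fun z _ => by rw [hc x' y' z]),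
      Finset.sum_eq_single_of_mem o ho (fun z _ hz => by rw [if_neg (Ne.symm hz)]; ring), if_pos rfl]
    ring
  simp_rw [inner]
  rw [Finset.sum_eq_single_of_mem x hx (fun x' _ hx' => by simp [if_neg (Ne.symm hx')]),
    Finset.sum_pair (by decide : ((0 : ℕ), (0 : ℕ)) ≠ (1, 0)), if_pos rfl]
  rcases hy with rfl | rfl <;> simp

/-- (R2), any other `P j`: the `w_ζ`-combination of its two terms of the flag row vanishes — no section `P j → X'`; or
`P j` below `h` on `f` (evaluation pairing onto `ξ̄_ζ^{(f)}`, killed by `w_ζ`); or `P j` a τ-ray partner of `X'` charged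
on `τ` (`≥ 2`-charged at height `h`: (F1) `noP`); or `P j` of `X'`'s class (`Minimal`). -/
theorem flag_term_not_isQ0 (hmin : D.Minimal φ) (η : Fin D.nP → (Fin 4 → ℕ) → (Fin 4 → ℕ × ℕ) → ℂ) {τ : Fin 4}
    (hτσ : τ ≠ T.σ) (hτf : τ ≠ T.f) {r : Fin D.nN} (hr : T.IsFlagOn τ r) {j : Fin D.nP} (hj : ¬ T.IsQ0 j)
    (x o : ℕ × ℕ) :
    (∑ u ∈ idxH2 (D.P j) (D.N T.i), ∑ a ∈ idxH0 (D.N r) (D.P j),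
        (if u.1 = qPair T.σ T.f then coefProd (rel (D.P j) (D.N T.i)) (rel (D.N r) (D.P j)) (qPair T.σ T.f) u.2 a
          (Function.update (Function.update (Function.update (fun _ => ((0 : ℕ), (0 : ℕ))) T.σ x) τ o) T.f (1, 0))
          else 0) * φ r j a * η j u.1 u.2) -
      zetaBar ((D.N T.i).phase T.f) *
      (∑ u ∈ idxH2 (D.P j) (D.N T.i), ∑ a ∈ idxH0 (D.N r) (D.P j),
        (if u.1 = qPair T.σ T.f then coefProd (rel (D.P j) (D.N T.i)) (rel (D.N r) (D.P j)) (qPair T.σ T.f) u.2 a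
          (Function.update (Function.update (Function.update (fun _ => ((0 : ℕ), (0 : ℕ))) T.σ x) τ o) T.f (0, 0))
          else 0) * φ r j a * η j u.1 u.2) = 0 := by
  obtain ⟨hFl, hFph, hFf, hFτ, hF0⟩ := hr
  by_cases hne : (idxH0 (D.N r) (D.P j)).Nonempty
  swap
  · rw [Finset.not_nonempty_iff_eq_empty.mp hne]
    simp
  obtain ⟨hl, hP0⟩ := (idxH0_nonempty_iff _ _).1 hne
  have hPg : ∀ g, g ≠ τ → g ≠ T.f → (D.P j).charge g = 0 := fun g hgτ hgf => by
    rcases hP0 g with h0 | ⟨-, hle⟩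
    · exact h0
    · have := hF0 g hgτ hgf; omega
  rw [Finset.mul_sum, ← Finset.sum_sub_distrib]
  refine Finset.sum_eq_zero fun u _ => ?_
  rw [Finset.mul_sum, ← Finset.sum_sub_distrib]
  refine Finset.sum_eq_zero fun a _ => ?_
  by_cases hu1 : u.1 = qPair T.σ T.f
  swap
  · rw [if_neg hu1, if_neg hu1]; ring
  rw [if_pos hu1, if_pos hu1]
  rcases Nat.lt_or_ge ((D.P j).charge T.f) ((D.N T.i).charge T.f) with hlt | hge
  · -- `c < h`: the `f`-factor is the evaluation pairing onto `ξ̄_ζ`, killed by `w_ζ`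
    have hph : (D.P j).charge T.f = 0 ∨ (D.N T.i).phase T.f = (D.P j).phase T.f := by
      rcases hP0 T.f with h0 | ⟨hp, -⟩
      · exact Or.inl h0
      · exact Or.inr (hFph.symm.trans hp)
    have hU : rel (D.P j) (D.N T.i) T.f = Rel.neg ((D.N T.i).charge T.f - (D.P j).charge T.f) ((D.N T.i).phase T.f) :=
      rel_of_lt _ _ T.f (hl.symm.trans hFl) hlt hph
    have hS : rel (D.N r) (D.P j) T.f = Rel.pos ((D.N r).charge T.f - (D.P j).charge T.f) ((D.N r).phase T.f) :=
      rel_pos_of_lt _ _ T.f hl (by rw [hFf]; exact hlt) (by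
        rcases hP0 T.f with h0 | ⟨hp, -⟩
        · exact Or.inl h0
        · exact Or.inr hp)
    rw [hFf, hFph] at hS
    have hc := coefProd_wImage_eq_zero_of_eval (rel (D.P j) (D.N T.i)) (rel (D.N r) (D.P j)) (qPair T.σ T.f) u.2 a
      (Function.update (Function.update (fun _ => ((0 : ℕ), (0 : ℕ))) T.σ x) τ o) T.f _ _ hU hS (qPair_right _ _)
    linear_combination (φ r j a * η j u.1 u.2) * hc
  · rcases hP0 T.f with h0 | ⟨hp, hle⟩
    · exfalso; have := T.flag_f; omega
    have hch : (D.P j).charge T.f = (D.N T.i).charge T.f := le_antisymm (by rw [← hFf]; exact hle) hge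
    by_cases hcτ : (D.P j).charge τ = 0
    · -- uncharged on `τ`: a copy of `Q₀`, excluded
      exfalso
      refine hj ⟨hPg T.σ hτσ.symm T.hσf, fun g hg => ?_⟩
      by_cases hgf : g = T.f
      · rw [hgf]; exact rel_zero_of_eq _ _ _ (hFl.symm.trans hl) hch.symm (Or.inr (hFph.symm.trans hp))
      by_cases hgτ : g = τ
      · rw [hgτ]; exact rel_zero_of_eq _ _ _ (hFl.symm.trans hl) (by rw [T.flag_supp τ hτσ hτf, hcτ]) (Or.inl hcτ)
      · exact rel_zero_of_eq _ _ _ (hFl.symm.trans hl) (by rw [T.flag_supp g hg hgf, hPg g hgτ hgf])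
          (Or.inl (hPg g hgτ hgf))
    obtain ⟨hpτ, hleτ⟩ := (hP0 τ).resolve_left hcτ
    rcases Nat.lt_or_ge ((D.P j).charge τ) ((D.N r).charge τ) with hltτ | hgeτ
    · -- a τ-ray partner of `X'` charged on `τ`: `≥ 2`-charged at height `h`
      exfalso
      have := T.noP j (two_le_nCharged _ τ T.f hτf hcτ (by rw [hch]; exact T.flag_f))
      omega
    · -- `X'`'s own class
      have hall : ∀ g, rel (D.N r) (D.P j) g = Rel.zero := fun g => by
        by_cases hgf : g = T.f
        · rw [hgf]; exact rel_zero_of_eq _ _ _ hl (hFf.trans hch.symm) (Or.inr hp)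
        by_cases hgτ : g = τ
        · rw [hgτ]; exact rel_zero_of_eq _ _ _ hl (le_antisymm hgeτ hleτ) (Or.inr hpτ)
        · exact rel_zero_of_eq _ _ _ hl (by rw [hF0 g hgτ hgf, hPg g hgτ hgf]) (Or.inl (hPg g hgτ hgf))
      rw [hmin r j hall a]; ring

/-- **(R2) THE FOREIGN-FLAG ROWS READ.** -/
theorem column_reading_R2 (hmin : D.Minimal φ) (η : Fin D.nP → (Fin 4 → ℕ) → (Fin 4 → ℕ × ℕ) → ℂ)
    (hη : ∀ r, ∀ t ∈ idxH2 (D.N r) (D.N T.i), D.lowerLHS φ η T.i r t =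
      if r = T.i then ob (D.N T.i) (Matrix.of fun a b => if a = T.f ∧ b = T.σ then (1 : ℂ) else 0) t.1 t.2 else 0)
    {τ : Fin 4} (hτσ : τ ≠ T.σ) (hτf : τ ≠ T.f) {r : Fin D.nN} (hr : T.IsFlagOn τ r) {x : ℕ × ℕ}
    (hx : x ∈ monIdx ((D.N T.i).charge T.σ)) {o : ℕ × ℕ} (ho : o ∈ monIdx ((D.N r).charge τ)) :
    ∑ j ∈ T.q0Set,
        (η j (qPair T.σ T.f) (Function.update (Function.update (fun _ => ((0 : ℕ), (0 : ℕ))) T.σ x) T.f (1, 0)) -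
            zetaBar ((D.N T.i).phase T.f) *
              η j (qPair T.σ T.f) (Function.update (Function.update (fun _ => ((0 : ℕ), (0 : ℕ))) T.σ x) T.f (0, 0))) *
          φ r j (Function.update (fun _ => ((0 : ℕ), (0 : ℕ))) τ o) = 0 := by
  classical
  obtain ⟨hFl, hFph, hFf, hFτ, hF0⟩ := id hr
  have hri : r ≠ T.i := fun h => by
    have := hF0 T.σ hτσ.symm T.hσf; rw [h] at this; exact T.flag_σ this
  -- `X' − X` per factor: `−a ℓ^{(σ)}`, `0` on `f`, `+a' ℓ^{(τ)}`, `0` on the fourth factor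
  have hσR : rel (D.N r) (D.N T.i) T.σ = Rel.neg ((D.N T.i).charge T.σ) ((D.N T.i).phase T.σ) :=
    rel_uncharged_charged _ _ T.σ hFl (hF0 T.σ hτσ.symm T.hσf) T.flag_σ
  have hfR : rel (D.N r) (D.N T.i) T.f = Rel.zero := rel_zero_of_eq _ _ T.f hFl hFf (Or.inr hFph)
  have hτR : rel (D.N r) (D.N T.i) τ = Rel.pos ((D.N r).charge τ) ((D.N r).phase τ) :=
    rel_charged_uncharged _ _ τ hFl.symm (T.flag_supp τ hτσ hτf) hFτ
  have hR0 : ∀ g, g ≠ T.σ → g ≠ T.f → g ≠ τ → rel (D.N r) (D.N T.i) g = Rel.zero := fun g hgσ hgf hgτ =>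
    rel_zero_of_eq _ _ g hFl (by rw [hF0 g hgτ hgf, T.flag_supp g hgσ hgf]) (Or.inl (T.flag_supp g hgσ hgf))
  have ht : ∀ y : ℕ × ℕ, (y = (0, 0) ∨ y = (1, 0)) →
      (qPair T.σ T.f, Function.update (Function.update (Function.update (fun _ => ((0 : ℕ), (0 : ℕ))) T.σ x) τ o)
        T.f y) ∈ idxH2 (D.N r) (D.N T.i) := by
    intro y hy
    refine (mem_idxH2_iff _ _ _).2 ⟨qPair_mem_qDist2 _ _ T.hσf, fun g => ?_⟩
    dsimp only
    by_cases hgf : g = T.f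
    · subst hgf; rw [Function.update_self, hfR, qPair_right, idx_zero_one]
      rcases hy with rfl | rfl <;> simp
    by_cases hgτ : g = τ
    · subst hgτ; rw [Function.update_of_ne hgf, Function.update_self, hτR, qPair_of_ne hτσ hgf, idx_pos_zero]; exact ho
    by_cases hgσ : g = T.σ
    · subst hgσ
      rw [Function.update_of_ne hgf, Function.update_of_ne hgτ, Function.update_self, hσR, qPair_left, idx_neg_one]
      exact hx
    rw [Function.update_of_ne hgf, Function.update_of_ne hgτ, Function.update_of_ne hgσ, hR0 g hgσ hgf hgτ,
      qPair_of_ne hgσ hgf, idx_zero_zero]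
    exact mem_singleton_self _
  have rowB := hη r _ (ht (1, 0) (Or.inr rfl))
  have rowA := hη r _ (ht (0, 0) (Or.inl rfl))
  rw [if_neg hri] at rowB rowA
  simp only [Design.lowerLHS] at rowB rowA
  have key := congrArg₂ (fun p q : ℂ => p - zetaBar ((D.N T.i).phase T.f) * q) rowB rowA
  simp only [sub_zero, mul_zero] at key
  rw [Finset.mul_sum, ← Finset.sum_sub_distrib, ← Finset.sum_filter_add_sum_filter_not univ (fun j => T.IsQ0 j),
    Finset.sum_eq_zero (s := univ.filter fun j => ¬ T.IsQ0 j) (fun j hj =>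
      flag_term_not_isQ0 T hmin η hτσ hτf hr (mem_filter.1 hj).2 x o), add_zero] at key
  unfold TopFlag.q0Set
  rw [← key]
  refine Finset.sum_congr rfl fun j hj => ?_
  have hj' : T.IsQ0 j := (mem_filter.1 hj).2
  rw [flag_term_isQ0 T η hτσ hτf hr hj' hx ho (1, 0) (Or.inr rfl), flag_term_isQ0 T η hτσ hτf hr hj' hx ho (0, 0) (Or.inl rfl)]
  ring

/-! ## The package -/

/-- **S3: THE COLUMN OF THE TOP FLAG READ** — (D) ∧ (R1) ∧ (R2) for the unknown block `v` of ONE solution of `X`'s column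
of (E1) at `κ₀ = E_{fσ}` (`LowerColumnSolvable`, one half of `H2` at one Weil direction). -/
theorem column_reading (hmin : D.Minimal φ)
    (h : D.LowerColumnSolvable φ (Matrix.of fun a b => if a = T.f ∧ b = T.σ then (1 : ℂ) else 0) T.i) :
    ∃ v : Fin D.nP → (ℕ × ℕ) → (ℕ × ℕ) → ℂ,
      (∑ j ∈ T.q0Set, ∑ x ∈ monIdx ((D.N T.i).charge T.σ),
          (v j x (1, 0) - zetaBar ((D.N T.i).phase T.f) * v j x (0, 0)) *
            φ T.i j (Function.update (fun _ => ((0 : ℕ), (0 : ℕ))) T.σ x) =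
        (if T.σ < T.f then 1 else -1) * ((D.N T.i).charge T.σ : ℂ)) ∧
      (∀ r, T.IsServer r → ∀ x ∈ monIdx ((D.N T.i).charge T.σ),
        ∀ o ∈ monIdx ((D.N r).charge T.f - (D.N T.i).charge T.f),
          ∑ j ∈ T.q0Set, (v j x (1, 0) - zetaBar ((D.N T.i).phase T.f) * v j x (0, 0)) *
              φ r j (Function.update (fun _ => ((0 : ℕ), (0 : ℕ))) T.f o) +
            ∑ j ∈ T.compSet ((D.N r).charge T.f), ∑ ι' ∈ monIdx ((D.P j).charge T.f - (D.N T.i).charge T.f),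
              ∑ a' ∈ monIdx ((D.N r).charge T.f - (D.P j).charge T.f),
                (mulCoef ι' a' o : ℂ) * v j x ι' * φ r j (Function.update (fun _ => ((0 : ℕ), (0 : ℕ))) T.f a') = 0) ∧
      (∀ τ, τ ≠ T.σ → τ ≠ T.f → ∀ r, T.IsFlagOn τ r → ∀ x ∈ monIdx ((D.N T.i).charge T.σ),
        ∀ o ∈ monIdx ((D.N r).charge τ),
          ∑ j ∈ T.q0Set, (v j x (1, 0) - zetaBar ((D.N T.i).phase T.f) * v j x (0, 0)) *
            φ r j (Function.update (fun _ => ((0 : ℕ), (0 : ℕ))) τ o) = 0) := by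
  obtain ⟨η, hη⟩ := h
  exact ⟨fun j x y => η j (qPair T.σ T.f) (Function.update (Function.update (fun _ => ((0 : ℕ), (0 : ℕ))) T.σ x) T.f y),
    column_reading_D T hmin η hη, fun r hr x hx o ho => column_reading_R1 T hmin η hη hr hx ho,
    fun τ hτσ hτf r hr x hx o ho => column_reading_R2 T hmin η hη hτσ hτf hr hx ho⟩

end FlagRows

end Summit.Ventures.HSemireg.Pad4FirstOrder
end
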